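import Summits.KontsevichZagierPeriods.Zeta5Search.Certificates.RecordRayDenominatorsBricks
import HarnessLib

/-!
# ζ(5) search — the record ray's DENOMINATORS, XI-b: the atlas of a checked LIST of windows (p3 g5)

HONEST FRAMING: systematic search; no irrationality claim unless certified.

OUR work (Summit side; prover seat p3, generation 5).  Continuation of file XI (`RecordRayDenominatorsBricks`: the window
record `BWin`, its Boolean check `BWin.ok` and the soundness `BWin.dvd_of_ok`).  Here, for any LIST `l : List BWin` with
`l.all BWin.ok = true` and consecutive separation `chainSep l = true` (both decidable, run by `decide` in the table files):
the `Fin l.length`-indexed atlas `Φ_n(l) = ∏_i (∏_{A_i n < p ≤ B_i n} p)^{k_i}` (`Hata1992.multiWindowProd`), pairwise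
disjointness from the chain (`BL_le_AL`), the multiplier `ML l n = M0 n / Φ_n(l)` with `ML·P_n, ML·Q(a·n) ∈ ℤ` for `n ≥ 10496`
(`multiWindowProd_dvd_int` + `BWin.dvd_of_ok`), the size `ML l n ≤ e^{(381.5232 − rateQ l + ε)n}` (`rateQ l = Σ k_i(B_i − A_i) ∈ ℚ`,
`rate_real`, prime number theorem via `eventually_exp_le_multiWindowProd`), and **`record_exponent_of_table`**: every
`γ ≥ 0` with `γ·((381.5232 − rateQ l) + 0.02 + 85.08768884) < 85.08768883 + 31.5452` is a hypothesis-free effective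
exponent of Brown–Zudilin's approximations (`record_exponent_rat`, file I).  Valuation bookkeeping; `γ < 1` — no
irrationality content.
-/

noncomputable section

open Finset Real Filter Topology

namespace Summit.KontsevichZagierPeriods.Zeta5Search.RecordRay

open Summit.KontsevichZagierPeriods.Zeta5Search.DualSeries
open Summit.KontsevichZagierPeriods.Zeta5Search.DualSeriesDenominators
open Summit.KontsevichZagierPeriods.Zeta5Search.WedgeDictionary
open Summit.KontsevichZagierPeriods.Zeta5Search.DualSeriesLemma19 (bRecord)
open Summit.KontsevichZagierPeriods.Zeta5Search.CasoratianValuation (casoratian shift)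
open Summit.KontsevichZagierPeriods.Zeta5Search.Denom.DigitCert (Cell)
open Summit.KontsevichZagierPeriods.Zeta5Search.Denom.RecordRayNuCells (nuCells)
open Summit.KontsevichZagierPeriods.Zeta5Search.Denom.RecordRayBrickCells (brick_cell)
open Literature.NumberTheory.Irrationality.Hata1992
open Literature.NumberTheory.Transcendental (zetaValue)

/-! ### Atlases from a checked LIST of windows -/

namespace BrickAtlas

/-- Left endpoints of the list, as reals, indexed by `Fin l.length`. -/
def AL (l : List BWin) (i : Fin l.length) : ℝ := ((l[i]).Aq : ℝ)

/-- Right endpoints of the list, as reals. -/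
def BL (l : List BWin) (i : Fin l.length) : ℝ := ((l[i]).Bq : ℝ)

/-- Exponents of the list. -/
def kL (l : List BWin) (i : Fin l.length) : ℕ := (l[i]).k

/-- The rate `k (B − A) ∈ ℚ` of one window. -/
def _root_.Summit.KontsevichZagierPeriods.Zeta5Search.RecordRay.BWin.rate (w : BWin) : ℚ := (w.k : ℚ) * (w.Bq - w.Aq)

/-- The rate `Σ_i k_i (B_i − A_i) ∈ ℚ` of a list of windows. -/
def rateQ (l : List BWin) : ℚ := (l.map BWin.rate).sum

/-- Consecutive separation `B_i ≤ A_{i+1}` (cross-multiplied), as a Boolean on the list. -/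
def chainSep : List BWin → Bool
  | v :: w :: rest => decide (v.b1 * w.a2 ≤ w.a1 * v.b2) && chainSep (w :: rest)
  | _ => true

variable {l : List BWin}

/-- Every window of a checked list is `ok`. -/
theorem ok_of_all (hok : l.all BWin.ok = true) (i : Fin l.length) : (l[i]).ok = true :=
  List.all_eq_true.1 hok _ (List.getElem_mem i.isLt)

/-- `0 ≤ A_i ≤ B_i`. -/
theorem AL_le_BL (hok : l.all BWin.ok = true) :
    ∀ i ∈ (univ : Finset (Fin l.length)), 0 ≤ AL l i ∧ AL l i ≤ BL l i :=
  fun i _ => BWin.Aq_le_Bq_of_ok (ok_of_all hok i)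

/-- The consecutive-separation Boolean, unfolded at position `i`. -/
theorem chainSep_succ : ∀ {l : List BWin}, chainSep l = true → ∀ (i : ℕ) (hi : i + 1 < l.length),
    (l[i]'(by omega)).b1 * (l[i + 1]'hi).a2 ≤ (l[i + 1]'hi).a1 * (l[i]'(by omega)).b2
  | [], _, i, hi => by simp at hi
  | [_], _, i, hi => by simp at hi
  | v :: w :: rest, h, 0, hi => by
      simp only [chainSep, Bool.and_eq_true, decide_eq_true_eq] at h
      simpa using h.1
  | v :: w :: rest, h, i + 1, hi => by
      simp only [chainSep, Bool.and_eq_true, decide_eq_true_eq] at h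
      have := chainSep_succ h.2 i (by simpa using hi)
      simpa using this

/-- `B_i ≤ A_{i+1}` over `ℝ`. -/
theorem BL_le_AL_succ (hok : l.all BWin.ok = true) (hch : chainSep l = true) (i : ℕ) (hi : i + 1 < l.length) :
    BL l ⟨i, by omega⟩ ≤ AL l ⟨i + 1, hi⟩ := by
  have hs := chainSep_succ hch i hi
  have h1 := ok_of_all hok ⟨i, by omega⟩
  have h2 := ok_of_all hok ⟨i + 1, hi⟩
  simp only [BWin.ok, BWin.okShape, Bool.and_eq_true, decide_eq_true_eq] at h1 h2
  obtain ⟨⟨⟨⟨⟨⟨-, -⟩, hb2⟩, -⟩, -⟩, -⟩, -⟩ := h1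
  obtain ⟨⟨⟨⟨⟨⟨-, ha2⟩, -⟩, -⟩, -⟩, -⟩, -⟩ := h2
  unfold BL AL BWin.Bq BWin.Aq
  simp only [Fin.getElem_fin]
  push_cast
  rw [div_le_div_iff₀ (by exact_mod_cast hb2) (by exact_mod_cast ha2)]
  exact_mod_cast hs

/-- Separation of all pairs `i < j`: `B_i ≤ A_j`. -/
theorem BL_le_AL (hok : l.all BWin.ok = true) (hch : chainSep l = true) :
    ∀ (d i : ℕ) (hj : i + 1 + d < l.length), BL l ⟨i, by omega⟩ ≤ AL l ⟨i + 1 + d, hj⟩ := by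
  intro d
  induction d with
  | zero => intro i hj; exact BL_le_AL_succ hok hch i hj
  | succ d ih =>
      intro i hj
      have h1 := ih i (by omega)
      have h2 := (AL_le_BL hok ⟨i + 1 + d, by omega⟩ (mem_univ _)).2
      have h3 := BL_le_AL_succ hok hch (i + 1 + d) (by simpa [Nat.add_assoc] using hj)
      have e : (⟨i + 1 + d + 1, by simpa [Nat.add_assoc] using hj⟩ : Fin l.length) = ⟨i + 1 + (d + 1), hj⟩ :=
        Fin.ext (by simp [Nat.add_assoc])
      rw [e] at h3
      linarith

/-- The windows of a checked, chain-separated list are pairwise disjoint prime sets. -/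
theorem disjointL (hok : l.all BWin.ok = true) (hch : chainSep l = true) (n : ℕ) :
    ∀ i ∈ (univ : Finset (Fin l.length)), ∀ j ∈ (univ : Finset (Fin l.length)), i ≠ j →
      Disjoint (windowPrimes (AL l i) (BL l i) n) (windowPrimes (AL l j) (BL l j) n) := by
  intro i _ j _ hij
  rw [Finset.disjoint_left]
  intro p hpi hpj
  obtain ⟨-, a1, b1⟩ := (mem_windowPrimes_iff (AL_le_BL hok i (mem_univ _)).1).1 hpi
  obtain ⟨-, a2, b2⟩ := (mem_windowPrimes_iff (AL_le_BL hok j (mem_univ _)).1).1 hpj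
  have hn : (0 : ℝ) ≤ n := Nat.cast_nonneg n
  rcases lt_or_gt_of_ne (Fin.val_ne_of_ne hij) with h | h
  · obtain ⟨d, hd⟩ : ∃ d, j.val = i.val + 1 + d := ⟨j.val - i.val - 1, by omega⟩
    have hsep := BL_le_AL hok hch d i.val (by rw [← hd]; exact j.isLt)
    have e1 : (⟨i.val, by omega⟩ : Fin l.length) = i := Fin.ext rfl
    have e2 : (⟨i.val + 1 + d, by rw [← hd]; exact j.isLt⟩ : Fin l.length) = j := Fin.ext hd.symm
    rw [e1, e2] at hsep
    nlinarith [mul_le_mul_of_nonneg_right hsep hn]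
  · obtain ⟨d, hd⟩ : ∃ d, i.val = j.val + 1 + d := ⟨i.val - j.val - 1, by omega⟩
    have hsep := BL_le_AL hok hch d j.val (by rw [← hd]; exact i.isLt)
    have e1 : (⟨j.val, by omega⟩ : Fin l.length) = j := Fin.ext rfl
    have e2 : (⟨j.val + 1 + d, by rw [← hd]; exact i.isLt⟩ : Fin l.length) = i := Fin.ext hd.symm
    rw [e1, e2] at hsep
    nlinarith [mul_le_mul_of_nonneg_right hsep hn]

/-- The window divisibilities of a checked list (`n ≥ 10496`). -/
theorem dvdL (hok : l.all BWin.ok = true) {n : ℕ} (hn : 10496 ≤ n)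
    {zW zV zW' zV' zU zU' : ℤ}
    (hzW : dRec n ^ 3 * sharpNormaliser (bRecord n) * coeffW (bRecord n) = zW)
    (hzV : dRec n ^ 6 * sharpNormaliser (bRecord n) * coeffV (bRecord n) = zV)
    (hzW' : dRec n ^ 3 * sharpNormaliser (bRecord' n) * coeffW (bRecord' n) = zW')
    (hzV' : dRec n ^ 6 * sharpNormaliser (bRecord' n) * coeffV (bRecord' n) = zV')
    (hzU : dRec n * sharpNormaliser (bRecord n) * coeffU (bRecord n) = zU)
    (hzU' : dRec n * sharpNormaliser (bRecord' n) * coeffU (bRecord' n) = zU') :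
    ∀ i ∈ (univ : Finset (Fin l.length)), ∀ p ∈ windowPrimes (AL l i) (BL l i) n,
      ((p : ℤ) ^ kL l i ∣ (zW' * zV - zW * zV')) ∧
      ((p : ℤ) ^ kL l i ∣ ((Nat.lcmUpto (41 * n) : ℤ) ^ 5 * (zU * zW') - (Nat.lcmUpto (41 * n) : ℤ) ^ 5 * (zU' * zW))) := by
  intro i _ p hp
  have hok1 := ok_of_all hok i
  obtain ⟨hpr, h1, h2⟩ := (mem_windowPrimes_iff (AL_le_BL hok i (mem_univ _)).1).1 hp
  exact BWin.dvd_of_ok hok1 hn hpr (BWin.lo_nat_of_ok hok1 h1) (BWin.hi_nat_of_ok hok1 h2) hzW hzV hzW' hzV' hzU hzU'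

/-- The window factor `Φ_n(l)`. -/
def corrL (l : List BWin) (n : ℕ) : ℕ := multiWindowProd univ (AL l) (BL l) (kL l) n

/-- **The multiplier** `ML l n = M0 n / Φ_n(l)`. -/
def ML (l : List BWin) (n : ℕ) : ℚ := M0 n / (corrL l n : ℚ)

/-- `Φ_n(l) > 0`. -/
theorem corrL_pos (l : List BWin) (n : ℕ) : 0 < corrL l n := multiWindowProd_pos _ _ _ _ _

/-- `0 < ML l n`. -/
theorem ML_pos (l : List BWin) (n : ℕ) : 0 < ML l n := div_pos (M0_pos n) (by exact_mod_cast corrL_pos l n)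

/-- **`ML l n · P_n ∈ ℤ`** (`n ≥ 10496`). -/
theorem ML_mul_recordP_int (hok : l.all BWin.ok = true) (hch : chainSep l = true) {n : ℕ} (hn : 10496 ≤ n) :
    ∃ z : ℤ, ML l n * recordP n = z := by
  classical
  have hn1 : 1 ≤ n := by omega
  obtain ⟨⟨zU, hzU⟩, ⟨zW, hzW⟩, ⟨zV, hzV⟩, ⟨zU', hzU'⟩, ⟨zW', hzW'⟩, ⟨zV', hzV'⟩⟩ := sharp_ints hn1
  obtain ⟨s, -, hρ⟩ := exists_sign_mul_abs _ (rhoOf_aRec_ne_zero n)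
  have habs : |rhoOf (aRec n)| ≠ 0 := abs_ne_zero.2 (rhoOf_aRec_ne_zero n)
  have hdiv : rhoOf (aRec n) / |rhoOf (aRec n)| = s := by rw [div_eq_iff habs]; exact hρ
  have key : M0 n * recordP n = (rhoOf (aRec n) / |rhoOf (aRec n)|) *
      ((dRec n ^ 3 * sharpNormaliser (bRecord' n) * coeffW (bRecord' n)) *
      (dRec n ^ 6 * sharpNormaliser (bRecord n) * coeffV (bRecord n)) -
      (dRec n ^ 3 * sharpNormaliser (bRecord n) * coeffW (bRecord n)) *
      (dRec n ^ 6 * sharpNormaliser (bRecord' n) * coeffV (bRecord' n))) := by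
    unfold M0 recordP
    field_simp
  rw [hdiv, hzW, hzV, hzW', hzV'] at key
  have hdvd : ((corrL l n : ℕ) : ℤ) ∣ (zW' * zV - zW * zV') := by
    apply multiWindowProd_dvd_int
    · intro i hi p hp
      exact ((dvdL hok hn hzW hzV hzW' hzV' hzU hzU') i hi p hp).1
    · exact disjointL hok hch n
  obtain ⟨q, hq⟩ := hdvd
  refine ⟨s * q, ?_⟩
  have hc : (corrL l n : ℚ) ≠ 0 := by exact_mod_cast (corrL_pos l n).ne'
  have e : (zW' : ℚ) * zV - zW * zV' = (corrL l n : ℚ) * q := by exact_mod_cast hq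
  calc ML l n * recordP n = M0 n * recordP n / corrL l n := by unfold ML; ring
    _ = s * ((zW' : ℚ) * zV - zW * zV') / corrL l n := by rw [key]
    _ = ((s * q : ℤ) : ℚ) := by rw [e]; push_cast; field_simp

/-- **`ML l n · Q(a·n) ∈ ℤ`** (`n ≥ 10496`). -/
theorem ML_mul_recordQ_int (hok : l.all BWin.ok = true) (hch : chainSep l = true) {n : ℕ} (hn : 10496 ≤ n) :
    ∃ z : ℤ, ML l n * recordQ n = z := by
  classical
  have hn1 : 1 ≤ n := by omega
  obtain ⟨⟨zU, hzU⟩, ⟨zW, hzW⟩, ⟨zV, hzV⟩, ⟨zU', hzU'⟩, ⟨zW', hzW'⟩, ⟨zV', hzV'⟩⟩ := sharp_ints hn1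
  obtain ⟨s, -, hρ⟩ := exists_sign_mul_abs _ (rhoOf_aRec_ne_zero n)
  have habs : |rhoOf (aRec n)| ≠ 0 := abs_ne_zero.2 (rhoOf_aRec_ne_zero n)
  have hdiv : rhoOf (aRec n) / |rhoOf (aRec n)| = s := by rw [div_eq_iff habs]; exact hρ
  have hQ := recordQ_eq_wedge hn1
  have key : M0 n * recordQ n = (rhoOf (aRec n) / |rhoOf (aRec n)|) * dRec n ^ 5 *
      ((dRec n * sharpNormaliser (bRecord n) * coeffU (bRecord n)) *
      (dRec n ^ 3 * sharpNormaliser (bRecord' n) * coeffW (bRecord' n)) -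
      (dRec n * sharpNormaliser (bRecord' n) * coeffU (bRecord' n)) *
      (dRec n ^ 3 * sharpNormaliser (bRecord n) * coeffW (bRecord n))) := by
    unfold M0
    rw [hQ]
    field_simp
  rw [hdiv, hzU, hzW, hzU', hzW'] at key
  set D : ℤ := (Nat.lcmUpto (41 * n) : ℤ) with hD
  have hdvd : ((corrL l n : ℕ) : ℤ) ∣ (D ^ 5 * (zU * zW') - D ^ 5 * (zU' * zW)) := by
    apply multiWindowProd_dvd_int
    · intro i hi p hp
      exact ((dvdL hok hn hzW hzV hzW' hzV' hzU hzU') i hi p hp).2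
    · exact disjointL hok hch n
  obtain ⟨q, hq⟩ := hdvd
  refine ⟨s * q, ?_⟩
  have hc : (corrL l n : ℚ) ≠ 0 := by exact_mod_cast (corrL_pos l n).ne'
  have hDq : (D : ℚ) = dRec n := by rw [hD]; unfold dRec; push_cast; rfl
  have e : (dRec n) ^ 5 * ((zU : ℚ) * zW' - zU' * zW) = (corrL l n : ℚ) * q := by
    rw [← hDq]; exact_mod_cast (by rw [← hq]; ring : D ^ 5 * (zU * zW' - zU' * zW) = (corrL l n : ℤ) * q)
  calc ML l n * recordQ n = M0 n * recordQ n / corrL l n := by unfold ML; ring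
    _ = s * (dRec n ^ 5 * ((zU : ℚ) * zW' - zU' * zW)) / corrL l n := by rw [key]; ring
    _ = ((s * q : ℤ) : ℚ) := by rw [e]; push_cast; field_simp

/-- The real rate of the `Fin`-indexed family is the rational `rateQ l`. -/
theorem rate_real (l : List BWin) : ∑ i ∈ (univ : Finset (Fin l.length)), (kL l i : ℝ) * (BL l i - AL l i) = ((rateQ l : ℚ) : ℝ) := by
  have h : ∀ i : Fin l.length, (kL l i : ℝ) * (BL l i - AL l i) = ((BWin.rate (l[(i : ℕ)]) : ℚ) : ℝ) := by
    intro i; simp only [kL, BL, AL, Fin.getElem_fin, BWin.rate]; push_cast; ring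
  rw [Finset.sum_congr rfl fun i _ => h i, ← Rat.cast_sum, rateQ, ← List.ofFn_getElem_eq_map l BWin.rate, List.sum_ofFn]

/-- **Size**: for every `ε > 0`, eventually `ML l n ≤ e^{(381.5232 − rateQ l + ε)·n}`. -/
theorem eventually_ML_le_exp (hok : l.all BWin.ok = true) {ε : ℝ} (hε : 0 < ε) :
    ∀ᶠ n : ℕ in atTop, ((ML l n : ℚ) : ℝ) ≤ Real.exp (((3815232 / 10000 - rateQ l : ℚ) + ε) * n) := by
  have hε2 : 0 < ε / 2 := by positivity
  have hΦ := eventually_exp_le_multiWindowProd (s := (univ : Finset (Fin l.length))) (w := kL l) (AL_le_BL hok) hε2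
  filter_upwards [eventually_M0_le_exp hε2, hΦ] with n hM0 hcorr
  rw [rate_real] at hcorr
  have hcorr' : Real.exp ((((rateQ l : ℚ) : ℝ) - ε / 2) * n) ≤ ((corrL l n : ℕ) : ℝ) := hcorr
  have hcpos : (0 : ℝ) < ((corrL l n : ℕ) : ℝ) := by exact_mod_cast corrL_pos l n
  have hcast : ((ML l n : ℚ) : ℝ) = ((M0 n : ℚ) : ℝ) / ((corrL l n : ℕ) : ℝ) := by
    unfold ML; push_cast; rfl
  rw [hcast]
  calc ((M0 n : ℚ) : ℝ) / ((corrL l n : ℕ) : ℝ) ≤ Real.exp ((3815232 / 10000 + ε / 2) * n) / ((corrL l n : ℕ) : ℝ) :=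
        div_le_div_of_nonneg_right hM0 hcpos.le
    _ ≤ Real.exp ((3815232 / 10000 + ε / 2) * n) / Real.exp ((((rateQ l : ℚ) : ℝ) - ε / 2) * n) :=
        div_le_div_of_nonneg_left (Real.exp_pos _).le (Real.exp_pos _) hcorr'
    _ = Real.exp (((3815232 / 10000 - rateQ l : ℚ) + ε) * n) := by rw [← Real.exp_sub]; push_cast; ring_nf

/-- **THE EXPONENT OF A TABLE, hypothesis-free.**  For a checked, chain-separated list of windows `l` and every `γ ≥ 0` with
`γ·((381.5232 − rateQ l) + 0.02 + 85.08768884) < 85.08768883 + 31.5452`: eventually `|ζ(5) − P_n/Q(a·n)| < 1/q_n^γ` with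
the integers `p_n = ML l n·P_n`, `q_n = ML l n·|Q(a·n)| ≥ 1`.  No irrationality content for `γ < 1`. -/
theorem record_exponent_of_table (hok : l.all BWin.ok = true) (hch : chainSep l = true) {γ : ℝ} (hγ0 : 0 ≤ γ)
    (hγ : γ * ((((3815232 / 10000 - rateQ l : ℚ) : ℝ) + 2 / 100) + 8508768884 / 10 ^ 8) <
      8508768883 / 10 ^ 8 + 315452 / 10000) :
    ∀ᶠ n : ℕ in atTop, ∃ p : ℤ, ∃ q : ℕ, 1 ≤ q ∧ (q : ℚ) = ML l n * |(recordQ n : ℚ)| ∧ (p : ℚ) = ML l n * recordP n ∧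
      |zetaValue 5 - (recordP n : ℝ) / (recordQ n : ℝ)| < 1 / (q : ℝ) ^ γ := by
  refine record_exponent_rat (lam := ((3815232 / 10000 - rateQ l : ℚ) : ℝ) + 2 / 100) (ML l) ?_ hγ0 hγ
  filter_upwards [eventually_ML_le_exp hok (show (0 : ℝ) < 2 / 100 by norm_num), eventually_ge_atTop 10496] with n hn hnN
  exact ⟨ML_pos l n, ML_mul_recordP_int hok hch hnN, ML_mul_recordQ_int hok hch hnN, hn⟩

end BrickAtlas

end Summit.KontsevichZagierPeriods.Zeta5Search.RecordRay
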